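import Mathlib
import Literature.NumberTheory.GaloisRepresentations.ResidualGaloisRep
import Literature.NumberTheory.GaloisRepresentations.ResidualGaloisRepOpenKernel
import Literature.NumberTheory.GaloisRepresentations.AdequateSubgroup
import Literature.NumberTheory.GaloisRepresentations.ExtendedAdequateSubgroup
import Literature.NumberTheory.GaloisRepresentations.ProjectiveType
import Literature.NumberTheory.GaloisRepresentations.AbsGaloisGroup
import Literature.NumberTheory.GaloisRepresentations.AdequateOfCoprimeOrder
import Literature.NumberTheory.GaloisRepresentations.ResidualRepUnique
import Literature.NumberTheory.GaloisRepresentations.CalegariEvenFontaineMazurTwo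
import Literature.RingTheory.Valuation.AlgClosedResidue
import Literature.RepresentationTheory.Semisimple.BurnsideMatrixSpan
import HarnessLib

/-!
# AdequacyDegreeTwoCharThree

Topic `Literature/NumberTheory/GaloisRepresentations`. Named literature fact(s) relocated by the gate from `Summits/Langlands/Langlands/Theorems/CoreAdequacySplitNoAdequateLayerLiftingStubRungRank2Ell3.lean`
(accept-time relocation of `[cite]`d propositions written inline in a Summits proposal; human ruling 2026-08-15).
Sources: BarnetlambGeeGeraghty2013MathAnn.

* `Literature.NumberTheory.GaloisRepresentations.blgg2013_propA21_three`
-/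

namespace Literature.NumberTheory.GaloisRepresentations

open scoped MatrixGroups
open Filter
open scoped Matrix
open Literature.NumberTheory.GaloisRepresentations

/-- **Barnet-Lamb–Gee–Geraghty, *Serre weights for rank two unitary groups*, Math. Ann. 356
(2013), Appendix A, Proposition A.2.1 (= arXiv:1106.5586, §6, Prop. 6.2.1) — the case `l = 3`.**
As printed: "Suppose that `l > 2` is a prime, and that `G ≤ GL₂(𝔽̄_l)` is a finite subgroup which
acts irreducibly on `𝔽̄_l²`. Then precisely one of the following is true: • We have `l = 3`, and
the image of `G` in `PGL₂(𝔽̄₃)` is conjugate to `PSL₂(𝔽₃)`. • We have `l = 5`, and the image of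
`G` in `PGL₂(𝔽̄₅)` is conjugate to `PGL₂(𝔽₅)` or `PSL₂(𝔽₅)`. • `G` is adequate."  Here
"adequate" is their Definition A.1.1 (the [BLGGT] formulation, "equivalent to [Thorne 2012] by
the discussion following the definition of adequacy in Section 2.1 of [BLGGT]"): "`H` has no
non-trivial quotient of `l`-power order (i.e. `H¹(H, 𝔽̄_l) = (0)`); `l ∤ n`; the elements of `H`
with order coprime to `l` span `M_{n×n}(𝔽̄_l)` over `𝔽̄_l`; `H¹(H, 𝔤𝔩_n(𝔽̄_l)) = (0)`", and
Remark A.2.2 / Point 9 of the proof: for `l = 3` an image isomorphic to `A₄` IS conjugate to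
`PSL₂(𝔽₃)` (`PSL₂(𝔽₃) ≅ A₄`).
RECORDED (statement only, no proof in the tree): the case `l = 3`, as the disjunction "the image
of `G` in `PGL₂` is isomorphic to `A₄`" (tree `IsTetrahedralType G.subtype`:
`Nonempty (projectiveImage G.subtype ≃* alternatingGroup (Fin 4))`) "OR clauses (1), (3), (4) of
Def. A.1.1 hold for `G`" ((2) reads `3 ∤ 2`): (1) as `Hom(G, k) = 0` (the printed parenthetical
`H¹(H, 𝔽̄_l) = 0`, as in the tree's `Subgroup.IsExtendedAdequate.addMonoidHom_eq_zero`), (3) as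
the tree's `Subgroup.semisimpleSpan G = ⊤` ("order coprime to `l`" = `(orderOf h).Coprime
(ringChar k)`), (4) as `H¹ = 0` for the tree's `Subgroup.adRep G` (`ad = 𝔤𝔩₂`) in Mathlib's
inhomogeneous cochains (`cocycles₁ ≤ coboundaries₁`); "acts irreducibly" is Mathlib's
`Representation.IsIrreducible` of the tautological representation (tree
`glRepresentation G.subtype`); `𝔽̄₃` is recorded as an algebraically closed field `k` of
characteristic `3` (the tree applies it to `ℤ̄₃/𝔪 = padicAlgClResidueField 3`; for a FINITE `G`
the statement does not see the difference between `𝔽̄₃` and an algebraically closed overfield —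
cohomology and spans commute with extension of scalars, cf. Guralnick–Herzig–Tiep 2017 §1, p. 4,
and this is how the tree records GHT 2017 Thm. 1.7, `ght2017_adequate_or_index_p_or_psl29`).
The mutual exclusivity and the cases `l ≥ 5` are not recorded.  The printed proof (arXiv
pp. 22–24) is a case analysis over Dickson's list (DDT Thm. 2.47 (b)) with Lemmas A.1.3–A.1.4,
the cohomology of `SL₂(𝔽_{3^a})` and of `2.A₅`; the tree has Dickson's theorem at the level of
orders only (`Literature.GroupTheory.SpecificGroups.PGL2.exists_smul_eq_or_of_dvd_card`).
-- TODO(general form): all primes `l > 2` with the `l = 5` exceptions, and "precisely one".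
[cite: BarnetlambGeeGeraghty2013MathAnn, App. A, Prop. A.2.1 (case l = 3); Def. A.1.1; Rem. A.2.2]
[file NumberTheory/GaloisRepresentations/AdequacyDegreeTwoCharThree] -/
def blgg2013_propA21_three : Prop :=
  ∀ (k : Type) [Field k] [IsAlgClosed k] [CharP k 3] (G : Subgroup (GL (Fin 2) k)) [Finite G],
    (Literature.NumberTheory.GaloisRepresentations.glRepresentation G.subtype).IsIrreducible →
    Literature.NumberTheory.GaloisRepresentations.IsTetrahedralType G.subtype ∨
      ((∀ f : Additive G →+ k, f = 0) ∧
        Literature.NumberTheory.GaloisRepresentations.Subgroup.semisimpleSpan G = ⊤ ∧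
        groupCohomology.cocycles₁
            (Rep.of (Literature.NumberTheory.GaloisRepresentations.Subgroup.adRep G)) ≤
          groupCohomology.coboundaries₁
            (Rep.of (Literature.NumberTheory.GaloisRepresentations.Subgroup.adRep G)))

/-! ### Finiteness of residual images; irreducible ⇒ absolutely irreducible over `k̄` -/

end Literature.NumberTheory.GaloisRepresentations
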